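import Summits.Schanuel.Schanuel.Theses.DiophantineDichotomy
import Summits.Schanuel.Schanuel.Theorems.DiophantineDichotomyApproximationPropertyDefs
import Summits.Schanuel.Schanuel.Theorems.DiophantineDichotomyApproximationPropertyLiftRoots
import Summits.Schanuel.Schanuel.Theorems.DiophantineDichotomyApproximationPropertyLiftHeights
import Summits.Schanuel.Schanuel.Theorems.DiophantineDichotomyApproximationPropertyLiftAlgebraic

/-!
# Lifting step for the approximation property (stub `stub_lift`, assembly)

Route `DiophantineDichotomy`, crux `ApproximationProperty` (stmt-Schanuel-6117), line
`orbit-interpolation-determinant`, registered stub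
`stub_lift : ∀ t, 1 ≤ t → (∀ t₀, 1 ≤ t₀ → t₀ ≤ t → PointAPAbsAt t₀) → PointwiseAPSlice t`
(vocabulary of `DiophantineDichotomyApproximationPropertyDefs`): from the point approximation
property in the WEIL currency at a transcendence basis `ω` of `ℚ(θ)` (`t₀ = trdeg ℚ(θ) ≤ t`) to
the crux's slice at exponent `t` in the NAIVE currency, for every finite tuple `θ : ι → ℂ`.

Proof (all constants depend on `θ`).  `t₀ = 0`: every coordinate is algebraic and `γ = θ` works
(`apDatum_of_forall_isAlgebraic`).  `t₀ ≥ 1`: choose a transcendence basis `ω` inside the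
coordinates (`exists_algIndep_basis`), the root-perturbation data `(Pᵢ, rᵢ, Lᵢ)` of every
coordinate (`exists_near_root`) and the height constants of the coefficient families of the `Pᵢ`
(`exists_logHeight_aeval_le`); apply `PointAPAbsAt t₀` at `ω` to get `(K, β, σ)` with
`D = [K:ℚ] ≤ (c₁Δ)^{t₀}`, `h = h_K(1:β) ≤ c₁YΔ^{t₀-1}`, `‖σβ - ω‖ ≤ ε = exp(-(Δh + YD)/c₁)`; lift
every coordinate to the nearest root `γ i` of `Pᵢ(σβ, ·)` (`‖γᵢ - θᵢ‖^{eᵢ} ≤ Lᵢ ε`); then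
`[ℚ(γ):ℚ] ≤ D ∏ eᵢ` (`finrank_adjoin_le_of_isRoot_map`), every `γ i` has a non-zero integer
polynomial of degree `≤ d` and coefficients `≤ exp(A h + B D)` (`exists_intPoly_of_isRoot_map`),
and the budgets `(cΔ)ᵗ`, `cYΔ^{t-1}`, `exp(-(log H·Δ + d·Y)/c)` follow for `c = c(θ)` large, using
`1 ≤ t₀ ≤ t`, `Δ ≤ Y` and the monotonicity of the budgets in the exponent.

Sources: NesterenkoPhilippon2001 (LNM 1752) Ch. 4 §4; LaurentRoy1999; folklore.
-/

-- `Summit.Schanuel.Schanuel.…` is the mandated summit/sub-problem namespace (single-conjunct summit), hence: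
set_option linter.dupNamespace false

namespace Summit.Schanuel.Schanuel.Cruxes.ApproximationProperty.OrbitInterpolationDeterminant

open Polynomial

noncomputable section

/-! ## The registered stub -/

/-- **Stub `stub_lift` — lifting and currency, sliced:
`(∀ t₀ ∈ [1, t], PointAPAbsAt t₀) → PointwiseAPSlice t`.**  For `θ : ι → ℂ` with
`trdeg ℚ(θ) = t₀ ≤ t`: `t₀ = 0` is the algebraic case; otherwise choose a transcendence basis
`ω` inside the coordinates, apply the point property at `ω` in dimension `t₀`, lift every
coordinate to the nearest root of its relation over `ℚ[ω]` specialised at `σ(β)`, and convert the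
Weil currency `([K:ℚ], h_K(1:β))` into the naive one `(d, log H)` through the tower law, Cauchy's
bound for the heights of roots, the heights of polynomial values and the Mahler–Weil identity;
the exponent `t₀ ≤ t` is absorbed by the monotonicity of the budgets (`1 ≤ t₀`, `Δ ≤ Y`). -/
theorem stub_lift :
    ∀ t : ℕ, 1 ≤ t → (∀ t₀ : ℕ, 1 ≤ t₀ → t₀ ≤ t → PointAPAbsAt t₀) → PointwiseAPSlice t := by
  intro t ht hP ι _ θ hθ
  classical
  obtain ⟨t₀, ht₀t, ω, hω, -, hdep⟩ := exists_algIndep_basis θ hθ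
  -- root-perturbation data of every coordinate
  choose P r L hr hL hdegP hPz using fun i => exists_near_root hω (hdep i)
  rcases Nat.eq_zero_or_pos t₀ with h0 | ht₀
  · -- `trdeg = 0`: every coordinate is algebraic
    subst h0
    refine apDatum_of_forall_isAlgebraic θ (fun i => ?_) ht
    obtain ⟨hlc, y, hy, hyθ⟩ := hPz i ω (by rw [sub_self, norm_zero]; exact (hr i).le)
    have hy0 : y = θ i := by
      have h1 : ‖y - θ i‖ ^ (P i).natDegree ≤ 0 := by
        have h := hyθ
        rwa [sub_self, norm_zero, mul_zero] at h
      have h2 : ‖y - θ i‖ ^ (P i).natDegree = 0 := le_antisymm h1 (by positivity)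
      rw [pow_eq_zero_iff (hdegP i).ne', norm_eq_zero, sub_eq_zero] at h2
      exact h2
    set q : ℚ[X] := (P i).map (MvPolynomial.aeval (Fin.elim0 : Fin 0 → ℚ)).toRingHom with hq
    have hqC : q.map (algebraMap ℚ ℂ) = (P i).map (MvPolynomial.aeval ω).toRingHom := by
      rw [hq, map_map_aeval]
      have : (fun j => algebraMap ℚ ℂ ((Fin.elim0 : Fin 0 → ℚ) j)) = ω := funext fun j => Fin.elim0 j
      rw [this]
    refine ⟨q, fun hq0 => ?_, ?_⟩
    · apply hlc
      have h1 : (P i).map (MvPolynomial.aeval ω).toRingHom = 0 := by rw [← hqC, hq0, Polynomial.map_zero]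
      have h2 := Polynomial.leadingCoeff_map_of_leadingCoeff_ne_zero
        (MvPolynomial.aeval ω).toRingHom (p := P i) hlc
      rw [h1, leadingCoeff_zero] at h2
      exact h2.symm
    · rw [aeval_def, ← eval_map, hqC, ← hy0]
      exact hy
  · -- `1 ≤ t₀ ≤ t`: the point property at the transcendence basis
    obtain ⟨c₁, hc₁, hpt⟩ := hP t₀ ht₀ ht₀t ω
    -- height constants of the coefficient families
    choose C hC0 hC using fun i =>
      exists_logHeight_aeval_le (fun k : Fin ((P i).natDegree + 1) => (P i).coeff k)
    -- the constants
    set E : ℕ := ∏ i, (P i).natDegree with hE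
    set e : ℕ := 1 + ∑ i, (P i).natDegree with he
    set r₀ : ℝ := (1 + ∑ i, (r i)⁻¹)⁻¹ with hr₀
    set L₀ : ℝ := 1 + ∑ i, L i with hL₀
    set Cs : ℝ := 1 + ∑ i, C i with hCs
    set A₁ : ℝ := E * Cs with hA₁
    set B₁ : ℝ := E * (Real.log (2 * ((e : ℝ) + 1)) + Cs) with hB₁
    set M : ℝ := A₁ + B₁ + E with hM
    -- elementary facts about the constants
    have hE1 : (1 : ℝ) ≤ E := by
      rw [hE]
      exact_mod_cast Finset.one_le_prod' fun i _ => hdegP i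
    have hE0 : (0 : ℝ) ≤ E := zero_le_one.trans hE1
    have hei : ∀ i, (P i).natDegree ≤ e := fun i => by
      rw [he]
      exact le_add_left (Finset.single_le_sum (f := fun i => (P i).natDegree)
        (fun _ _ => Nat.zero_le _) (Finset.mem_univ i))
    have he1 : 1 ≤ e := by rw [he]; omega
    have he0 : (0 : ℝ) ≤ e := Nat.cast_nonneg _
    have hr₀pos : 0 < r₀ := by
      rw [hr₀]
      exact inv_pos.mpr (by linarith [Finset.sum_nonneg fun i (_ : i ∈ Finset.univ) =>
        (inv_pos.mpr (hr i)).le])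
    have hr₀le1 : r₀ ≤ 1 := by
      rw [hr₀]
      exact inv_le_one_of_one_le₀ (by linarith [Finset.sum_nonneg fun i (_ : i ∈ Finset.univ) =>
        (inv_pos.mpr (hr i)).le])
    have hr₀le : ∀ i, r₀ ≤ r i := fun i => by
      rw [hr₀]
      have h1 : (r i)⁻¹ ≤ 1 + ∑ j, (r j)⁻¹ := by
        have := Finset.single_le_sum (f := fun j => (r j)⁻¹) (fun j _ => (inv_pos.mpr (hr j)).le)
          (Finset.mem_univ i)
        linarith
      have h2 := inv_anti₀ (inv_pos.mpr (hr i)) h1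
      rwa [inv_inv] at h2
    have hlogr₀ : Real.log r₀ ≤ 0 := Real.log_nonpos hr₀pos.le hr₀le1
    have hL₀1 : 1 ≤ L₀ := by
      rw [hL₀]
      linarith [Finset.sum_nonneg fun i (_ : i ∈ Finset.univ) => (hL i).le]
    have hL₀pos : 0 < L₀ := one_pos.trans_le hL₀1
    have hLi : ∀ i, L i ≤ L₀ := fun i => by
      rw [hL₀]
      have := Finset.single_le_sum (f := fun j => L j) (fun j _ => (hL j).le) (Finset.mem_univ i)
      linarith
    have hlogL₀ : 0 ≤ Real.log L₀ := Real.log_nonneg hL₀1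
    have hCs1 : 1 ≤ Cs := by
      rw [hCs]
      linarith [Finset.sum_nonneg fun i (_ : i ∈ Finset.univ) => hC0 i]
    have hCs0 : 0 ≤ Cs := zero_le_one.trans hCs1
    have hCi : ∀ i, C i ≤ Cs := fun i => by
      rw [hCs]
      have := Finset.single_le_sum (f := fun j => C j) (fun j _ => hC0 j) (Finset.mem_univ i)
      linarith
    have hlog2e : 0 ≤ Real.log (2 * ((e : ℝ) + 1)) := Real.log_nonneg (by linarith)
    have hA₁0 : 0 ≤ A₁ := by rw [hA₁]; exact mul_nonneg hE0 hCs0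
    have hB₁0 : 0 ≤ B₁ := by rw [hB₁]; exact mul_nonneg hE0 (add_nonneg hlog2e hCs0)
    have hM0 : 0 ≤ M := by rw [hM]; linarith
    have hc₁pos : 0 < c₁ := one_pos.trans_le hc₁
    have hct : 0 ≤ B₁ * c₁ ^ t := mul_nonneg hB₁0 (pow_nonneg hc₁pos.le _)
    have h2eM : 0 ≤ 2 * (e : ℝ) * M := by positivity
    -- the constant `c = c₁ Z`
    set Z : ℝ := 1 + E + (A₁ + B₁ * c₁ ^ t) + 2 * e * M + 2 * Real.log L₀ - Real.log r₀ with hZ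
    have hZ1 : 1 ≤ Z := by rw [hZ]; linarith
    have hZ0 : 0 ≤ Z := zero_le_one.trans hZ1
    have hZE : (E : ℝ) ≤ Z := by rw [hZ]; linarith
    have hZAB : A₁ + B₁ * c₁ ^ t ≤ Z := by rw [hZ]; linarith
    have hZeM : 2 * (e : ℝ) * M ≤ Z := by rw [hZ]; linarith
    have hZL : 2 * Real.log L₀ ≤ Z := by rw [hZ]; linarith
    have hZr : -Real.log r₀ ≤ Z := by rw [hZ]; linarith
    set c : ℝ := c₁ * Z with hc
    have hcZ : ∀ x : ℝ, x ≤ Z → c₁ * x ≤ c := fun x hx => by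
      rw [hc]
      exact mul_le_mul_of_nonneg_left hx hc₁pos.le
    have hcc₁ : c₁ ≤ c := by simpa using hcZ 1 hZ1
    have hc1 : 1 ≤ c := hc₁.trans hcc₁
    have hc0 : 0 < c := one_pos.trans_le hc1
    refine ⟨c, hc1, fun Δ Y hΔ hY => ?_⟩
    have hΔ1 : 1 ≤ Δ := hc1.trans hΔ
    have hΔ0 : 0 ≤ Δ := zero_le_one.trans hΔ1
    have hY0 : 0 ≤ Y := hΔ0.trans hY
    -- the point property at scale `(Δ, Y)`
    obtain ⟨K, _instK, _instNF, β, σ, hD, hh, hdist⟩ := hpt Δ Y (hcc₁.trans hΔ) hY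
    set D : ℕ := Module.finrank ℚ K with hDdef
    set hK : ℝ := Height.logHeight (Fin.cons (1 : K) β : Fin (t₀ + 1) → K) with hhK
    have hD1 : (1 : ℝ) ≤ D := by rw [hDdef]; exact_mod_cast Module.finrank_pos
    have hK0 : 0 ≤ hK := Height.logHeight_nonneg _
    set S : ℝ := Δ * hK + Y * D with hS
    have hSY : Y ≤ S := by
      rw [hS]
      have h1 : Y * 1 ≤ Y * D := mul_le_mul_of_nonneg_left hD1 hY0
      have h2 : 0 ≤ Δ * hK := mul_nonneg hΔ0 hK0
      linarith only [h1, h2]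
    have hSc : c ≤ S := hΔ.trans (hY.trans hSY)
    have hS0 : 0 ≤ S := hc0.le.trans hSc
    set z : Fin t₀ → ℂ := fun j => σ (β j) with hz
    -- `ε ≤ r₀`
    have hεr₀ : Real.exp (-(S / c₁)) ≤ r₀ := by
      have h1 : -(S / c₁) ≤ Real.log r₀ := by
        rw [neg_le, le_div_iff₀ hc₁pos]
        have h2 : c₁ * -Real.log r₀ ≤ c := hcZ _ hZr
        linarith only [h2, hSc]
      calc Real.exp (-(S / c₁)) ≤ Real.exp (Real.log r₀) := Real.exp_le_exp.mpr h1
        _ = r₀ := Real.exp_log hr₀pos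
    have hzr : ∀ i, ‖z - ω‖ ≤ r i := fun i => (hdist.trans hεr₀).trans (hr₀le i)
    -- the lifted tuple
    have hroots : ∀ i, ∃ y : ℂ, (MvPolynomial.aeval z (P i).leadingCoeff ≠ 0 ∧
        ((P i).map (MvPolynomial.aeval z).toRingHom).IsRoot y) ∧
        ‖y - θ i‖ ^ (P i).natDegree ≤ L i * ‖z - ω‖ := fun i => by
      obtain ⟨h1, y, h2, h3⟩ := hPz i z (hzr i)
      exact ⟨y, ⟨h1, h2⟩, h3⟩
    choose γ hγ hγdist using hroots
    set q : ι → K[X] := fun i => (P i).map (MvPolynomial.aeval β).toRingHom with hq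
    have hqσ : ∀ i, (q i).map σ = (P i).map (MvPolynomial.aeval z).toRingHom := fun i =>
      map_map_aeval σ β (P i)
    have hq0 : ∀ i, q i ≠ 0 := fun i h0 => by
      apply (hγ i).1
      have h1 : (P i).map (MvPolynomial.aeval z).toRingHom = 0 := by
        rw [← hqσ, h0, Polynomial.map_zero]
      have h2 := Polynomial.leadingCoeff_map_of_leadingCoeff_ne_zero
        (MvPolynomial.aeval z).toRingHom (p := P i) (hγ i).1
      rw [h1, leadingCoeff_zero] at h2
      exact h2.symm
    have hroot : ∀ i, ((q i).map σ).IsRoot (γ i) := fun i => by rw [hqσ]; exact (hγ i).2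
    have hdegq : ∀ i, (q i).natDegree ≤ (P i).natDegree := fun i => natDegree_map_le
    -- degree
    have hfin := finrank_adjoin_le_of_isRoot_map σ γ q hq0 hroot (fun i => (P i).natDegree) hdegq
    set d : ℕ := D * E with hd
    have hint : ∀ i, IsIntegral ℚ (γ i) := fun i => isIntegral_of_isRoot_map σ (hq0 i) (hroot i)
    have hmin : ∀ i, (minpoly ℚ (γ i)).natDegree ≤ d := fun i =>
      (natDegree_minpoly_le_finrank_adjoin γ hint i).trans hfin
    -- the integer polynomials
    choose Pz hPz0 hPzroot hPzdeg hPzcoeff using fun i =>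
      exists_intPoly_of_isRoot_map σ (hq0 i) (hroot i) (hdegq i)
    have hcoeffq : ∀ i, Height.logHeight (fun k : Fin ((P i).natDegree + 1) => (q i).coeff k) ≤
        C i * (D + hK) := fun i => by
      have h1 : (fun k : Fin ((P i).natDegree + 1) => (q i).coeff k) =
          fun k : Fin ((P i).natDegree + 1) => MvPolynomial.aeval β ((P i).coeff k) := by
        funext k
        simp only [hq, Polynomial.coeff_map, AlgHom.toRingHom_eq_coe, RingHom.coe_coe]
      rw [h1]
      exact hC i K β
    -- the common coefficient bound `W = exp(A₁ h + B₁ D)`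
    set X : ℝ := 2 * ((e : ℝ) + 1) * Real.exp (Cs * (D + hK) / D) with hX
    have hX1 : 1 ≤ X := by
      rw [hX]
      have h1 : (1 : ℝ) ≤ 2 * ((e : ℝ) + 1) := by linarith only [he0]
      have h2 : 1 ≤ Real.exp (Cs * (D + hK) / D) := Real.one_le_exp (by positivity)
      exact one_le_mul_of_one_le_of_one_le h1 h2
    have hX0 : 0 < X := one_pos.trans_le hX1
    have hlogX : Real.log X = Real.log (2 * ((e : ℝ) + 1)) + Cs * (D + hK) / D := by
      rw [hX, Real.log_mul (by positivity) (Real.exp_pos _).ne', Real.log_exp]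
    set W : ℝ := Real.exp (A₁ * hK + B₁ * D) with hW
    have hdlogX : (d : ℝ) * Real.log X = A₁ * hK + B₁ * D := by
      rw [hlogX, hd, hA₁, hB₁, Nat.cast_mul]
      have hD0 : (D : ℝ) ≠ 0 := (one_pos.trans_le hD1).ne'
      field_simp
      ring
    have hcoeffW : ∀ i k, (|(Pz i).coeff k| : ℝ) ≤ W := by
      intro i k
      refine (hPzcoeff i k).trans ?_
      have hXi : 2 * (((P i).natDegree : ℝ) + 1) *
          Real.exp (Height.logHeight (fun k : Fin ((P i).natDegree + 1) => (q i).coeff k) / D) ≤ X := by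
        rw [hX]
        have h1 : (((P i).natDegree : ℝ) + 1) ≤ (e : ℝ) + 1 := by exact_mod_cast Nat.succ_le_succ (hei i)
        have h2 : Height.logHeight (fun k : Fin ((P i).natDegree + 1) => (q i).coeff k) / D ≤
            Cs * (D + hK) / D := by
          apply div_le_div_of_nonneg_right _ (zero_le_one.trans hD1)
          refine (hcoeffq i).trans ?_
          exact mul_le_mul_of_nonneg_right (hCi i) (by positivity)
        have h3 := Real.exp_le_exp.mpr h2
        have h4 : (0 : ℝ) ≤ 2 * (((P i).natDegree : ℝ) + 1) := by positivity
        calc 2 * (((P i).natDegree : ℝ) + 1) *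
              Real.exp (Height.logHeight (fun k : Fin ((P i).natDegree + 1) => (q i).coeff k) / D)
            ≤ 2 * (((P i).natDegree : ℝ) + 1) * Real.exp (Cs * (D + hK) / D) :=
              mul_le_mul_of_nonneg_left h3 h4
          _ ≤ 2 * ((e : ℝ) + 1) * Real.exp (Cs * (D + hK) / D) := by
              apply mul_le_mul_of_nonneg_right _ (Real.exp_pos _).le
              linarith only [h1]
      have hn : (Pz i).natDegree ≤ d := (hPzdeg i).le.trans (hmin i)
      have h0 : (0 : ℝ) ≤ 2 * (((P i).natDegree : ℝ) + 1) *
          Real.exp (Height.logHeight (fun k : Fin ((P i).natDegree + 1) => (q i).coeff k) / D) := by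
        positivity
      calc (2 * (((P i).natDegree : ℝ) + 1) *
            Real.exp (Height.logHeight (fun k : Fin ((P i).natDegree + 1) => (q i).coeff k) / D)) ^
            (Pz i).natDegree
          ≤ X ^ (Pz i).natDegree := pow_le_pow_left₀ h0 hXi _
        _ ≤ X ^ d := pow_le_pow_right₀ hX1 hn
        _ = Real.exp (d * Real.log X) := by rw [Real.exp_nat_mul, Real.exp_log hX0]
        _ = W := by rw [hW, hdlogX]
    have hW1 : 1 ≤ W := by
      rw [hW]
      exact Real.one_le_exp (by positivity)
    set H : ℕ := ⌊W⌋₊ with hH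
    have hH1 : 1 ≤ H := by
      rw [hH]
      exact Nat.le_floor (by exact_mod_cast hW1)
    have hHW : (H : ℝ) ≤ W := Nat.floor_le (zero_le_one.trans hW1)
    have hHpos : (0 : ℝ) < H := by exact_mod_cast hH1
    have hlogH : Real.log H ≤ A₁ * hK + B₁ * D := by
      have := Real.log_le_log hHpos hHW
      rwa [hW, Real.log_exp] at this
    have hlogH0 : 0 ≤ Real.log H := Real.log_nonneg (by exact_mod_cast hH1)
    have hcoeffH : ∀ i k, |(Pz i).coeff k| ≤ (H : ℤ) := by
      intro i k
      rw [hH, Int.natCast_floor_eq_floor (zero_le_one.trans hW1), Int.le_floor]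
      push_cast
      exact hcoeffW i k
    -- the budgets
    have hc₁Δ : 1 ≤ c₁ * Δ := one_le_mul_of_one_le_of_one_le hc₁ hΔ1
    have hDt : (D : ℝ) ≤ (c₁ * Δ) ^ t := hD.trans (pow_le_pow_right₀ hc₁Δ ht₀t)
    have hpowΔ : Δ ^ (t₀ - 1) ≤ Δ ^ (t - 1) := pow_le_pow_right₀ hΔ1 (by omega)
    have hDY : (D : ℝ) ≤ c₁ ^ t * (Y * Δ ^ (t - 1)) := by
      refine hD.trans ?_
      have h1 : (c₁ * Δ) ^ t₀ = c₁ ^ t₀ * (Δ * Δ ^ (t₀ - 1)) := by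
        rw [mul_pow, ← pow_succ', Nat.sub_add_cancel ht₀]
      rw [h1]
      have h2 : c₁ ^ t₀ ≤ c₁ ^ t := pow_le_pow_right₀ hc₁ ht₀t
      have h3 : Δ * Δ ^ (t₀ - 1) ≤ Y * Δ ^ (t - 1) :=
        mul_le_mul hY hpowΔ (by positivity) hY0
      exact mul_le_mul h2 h3 (by positivity) (by positivity)
    have hhK : hK ≤ c₁ * Y * Δ ^ (t - 1) := by
      refine hh.trans ?_
      exact mul_le_mul_of_nonneg_left hpowΔ (by positivity)
    refine ⟨γ, d, H, hfin, fun i => ⟨Pz i, hPz0 i, (hPzdeg i).le.trans (hmin i), hcoeffH i,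
      hPzroot i⟩, ?_, ?_, ?_⟩
    · -- `d ≤ (cΔ)^t`
      have h1 : (d : ℝ) = D * E := by rw [hd, Nat.cast_mul]
      rw [h1]
      calc (D : ℝ) * E ≤ (c₁ * Δ) ^ t * E := mul_le_mul_of_nonneg_right hDt (by positivity)
        _ ≤ (c₁ * Δ) ^ t * (E : ℝ) ^ t := by
            apply mul_le_mul_of_nonneg_left (le_self_pow₀ hE1 (by omega)) (by positivity)
        _ = (E * c₁ * Δ) ^ t := by rw [← mul_pow]; ring
        _ ≤ (c * Δ) ^ t := by
            apply pow_le_pow_left₀ (by positivity)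
            apply mul_le_mul_of_nonneg_right _ hΔ0
            rw [mul_comm]
            exact hcZ _ hZE
    · -- `log H ≤ c Y Δ^(t-1)`
      calc Real.log H ≤ A₁ * hK + B₁ * D := hlogH
        _ ≤ A₁ * (c₁ * Y * Δ ^ (t - 1)) + B₁ * (c₁ ^ t * (Y * Δ ^ (t - 1))) := by
            gcongr
        _ = (A₁ * c₁ + B₁ * c₁ ^ t) * (Y * Δ ^ (t - 1)) := by ring
        _ ≤ c * (Y * Δ ^ (t - 1)) := by
            apply mul_le_mul_of_nonneg_right _ (by positivity)
            have h1 : A₁ ≤ c₁ * A₁ := le_mul_of_one_le_left hA₁0 hc₁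
            have h2 : B₁ * c₁ ^ t ≤ c₁ * (B₁ * c₁ ^ t) := le_mul_of_one_le_left hct hc₁
            have h3 : c₁ * (A₁ + B₁ * c₁ ^ t) ≤ c := hcZ _ hZAB
            linarith only [h1, h2, h3]
        _ = c * Y * Δ ^ (t - 1) := by ring
    · -- accuracy
      have hnum : Real.log H * Δ + d * Y ≤ M * S := by
        have h1 : (d : ℝ) = D * E := by rw [hd, Nat.cast_mul]
        rw [h1, hM, hS]
        have h2 : Real.log H * Δ ≤ (A₁ * hK + B₁ * D) * Δ := mul_le_mul_of_nonneg_right hlogH hΔ0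
        have h3 : B₁ * D * Δ ≤ B₁ * D * Y := mul_le_mul_of_nonneg_left hY (by positivity)
        have h4 : 0 ≤ A₁ * (Y * D) := by positivity
        have h5 : 0 ≤ B₁ * (Δ * hK) := by positivity
        have h6 : 0 ≤ E * (Δ * hK) := by positivity
        linarith only [h2, h3, h4, h5, h6]
      have hexp : Real.exp (-(M * S / c)) ≤ Real.exp (-((Real.log H * Δ + d * Y) / c)) := by
        rw [Real.exp_le_exp, neg_le_neg_iff]
        exact div_le_div_of_nonneg_right hnum hc0.le
      refine le_trans ?_ hexp
      rw [pi_norm_le_iff_of_nonneg (Real.exp_pos _).le]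
      intro i
      rw [Pi.sub_apply]
      -- `‖γ i - θ i‖ ^ eᵢ ≤ L₀ ε ≤ exp(-S/(2c₁)) ≤ exp(-M S/c) ^ eᵢ`
      have hεS : ‖z - ω‖ ≤ Real.exp (-(S / c₁)) := hdist
      have h1 : ‖γ i - θ i‖ ^ (P i).natDegree ≤ L₀ * Real.exp (-(S / c₁)) :=
        (hγdist i).trans (mul_le_mul (hLi i) hεS (norm_nonneg _) hL₀pos.le)
      have hSL : 2 * c₁ * Real.log L₀ ≤ S := by
        refine le_trans ?_ hSc
        calc 2 * c₁ * Real.log L₀ = c₁ * (2 * Real.log L₀) := by ring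
          _ ≤ c := hcZ _ hZL
      have hcM : 2 * c₁ * (e * M) ≤ c := by
        calc 2 * c₁ * (e * M) = c₁ * (2 * e * M) := by ring
          _ ≤ c := hcZ _ hZeM
      exact accuracy_aux (norm_nonneg _) (hdegP i) (hei i) hL₀pos hc₁pos hc0 hM0 hS0 hSL hcM h1

end

end Summit.Schanuel.Schanuel.Cruxes.ApproximationProperty.OrbitInterpolationDeterminant
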